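import Summits.CriticalPhenomena.PercolationContinuityZ3.Theorems.PercNearOneGluingNoHeavyConstsSingleEdgeDisconnection
import Literature.Probability.Percolation.TwoSetExchange
import HarnessLib
import HarnessLib.Audit.Tags

/-!
# Two DECORATED exchange inequalities for the first spoiler member `M₁` of the vertex-profile family
# (PAPER-2 track (ii): constants of the CSH family)

builds on p205010 (kernel theorem, internal audit signed; external expert review pending).  Support file (`--supports
stmt-CriticalPhenomena-4575`), seat `prim-consts-2` (gen 8); memo `run/shared/lean/prim/consts/FROM-prim-consts-2-g8-STAR-PEEL.md` §4
(addendum 2).  No definitions, no named facts, no sorries; standard axioms.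

Five points `x, u, v, o, z`; `D = {x ↮ {v,o}}` (the clusters of `v, o` avoid `x`), `I = {v ↔ o}`, `A = {u ∈ C_v ∪ C_o}`, and the "spoiler
decorations" `F = {z ∉ C_x}`, `F′ = {z ∉ C_x ∪ C_u}`.  The avoided-set-free five-point inequality `M₁ ≥ 0` of the memo (§4) decomposes as
`M₁ = K(xuv,z)·D₀ + G2 + (covariance block)` with the "decorated D₀"
`G2 = P(D∩I∩A∩F)P(D∩Aᶜ) + P(D∩I∩A)P(D∩Aᶜ∩F′) − P(D∩I∩Aᶜ∩F′)P(D∩A) − P(D∩I∩Aᶜ)P(D∩A∩F) + …`; two of the product inequalities that enter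
(both exact-verified, memo §4 add. 2: 0 failures / 2 520 instances) are single instances of the two-set exchange inequality
(`setTwoClusterExchange`, van den Berg–Häggström–Kahn Thm 1.5/2.1 with sets) for the pairs of cluster families `(C_{{v,o}}, C_x)`
resp. `(C_{{v,o,z}}, C_x)` — the decoration `z ∉ C_x` is of type `(+)` because it only asks the cluster of `x` to be small:

* `Consts.spoilerExchange_zNotInCx` — **(I4) `P(D∩I∩Aᶜ) · P(D∩A∩F) ≤ P(D∩I∩A∩F) · P(D∩Aᶜ)`**: on `D = {{v,o} ↮ x}` the events `I = {v ↔ o}`,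
  `A ∩ F = {u ∈ C_{vo}} ∩ {z ∉ C_x}` are of type `(+)` and `Aᶜ = {u ∉ C_{vo}}` of type `(−)`.
* `Consts.spoilerExchange_zSource` — **(I10) `P(v↔o, {v,o,z} ↮ {x,u}) · P({v,o,z} ↮ x, u ∈ C_{vo}) ≤ P(v↔o, u ∈ C_{vo}, {v,o,z} ↮ x) · P({v,o,z} ↮ {x,u})`**
  (van den Berg–Häggström–Kahn's Theorem 1.1 for the source SET `{v,o,z}` with the increasing events `{v ↔ o}`, `{u ∈ C_v ∪ C_o}` and the
  avoided sets `{x,u}`, `{x}`): on `D_z = {{v,o,z} ↮ x}`, `{v ↔ o}` and `{u ∈ C_v ∪ C_o}` are of type `(+)`, `{u ∉ C_{voz}}` of type `(−)`.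
The undecorated instance (`z` absent) of either is the exchange behind `D₀ ≥ 0` (`Consts.chainRule_voAvoid_noTarget`, p305568).
[cite: VandenbergHaggstromKahn2005, Thm. 1.5 (p. 7), Thm. 2.1 (p. 9), Remark 1 after Thm. 1.2 (p. 5), Thm. 1.1 (pp. 3–5)]
-/

noncomputable section

namespace Summit.CriticalPhenomena.PercolationContinuityZ3.Theorems

open MeasureTheory Set Literature.Probability.LatticeModels Literature.Probability.Percolation
open scoped Classical

namespace Consts

variable {V : Type*} [Fintype V]

/-- **(I4) — the target-side spoiler exchange.**  With `S = {v,o}`, `D = {S ↮ x}`: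
`μ(D ∩ {v↔o} ∩ {u ∉ C_S}) · μ(D ∩ {u ∈ C_S} ∩ {z ∉ C_x}) ≤ μ(D ∩ {v↔o} ∩ {u ∈ C_S} ∩ {z ∉ C_x}) · μ(D ∩ {u ∉ C_S})`
(`{u ∈ C_S} = ⋃_{s ∈ S} {s ↔ u}`, `{z ∉ C_x} = (⋃_{t ∈ {x}} {t ↔ z})ᶜ`).
[cite: VandenbergHaggstromKahn2005, Thm. 2.1 (p. 9) at q = 1, Thm. 1.5 (p. 7) with Remark 1 after Thm. 1.2 (p. 5)] -/
theorem spoilerExchange_zNotInCx (w : Sym2 V → unitInterval) (x u v o z : V) :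
    (prodBernoulli w).real ({ω : BondConfig V | ∀ s ∈ ({v, o} : Set V), ∀ t ∈ ({x} : Set V), ¬ (openGraph ω).Reachable s t} ∩
        ((openConn v o : Set (BondConfig V)) ∩ (⋃ s ∈ ({v, o} : Set V), (openConn s u : Set (BondConfig V)))ᶜ)) *
      (prodBernoulli w).real ({ω : BondConfig V | ∀ s ∈ ({v, o} : Set V), ∀ t ∈ ({x} : Set V), ¬ (openGraph ω).Reachable s t} ∩
        ((⋃ s ∈ ({v, o} : Set V), (openConn s u : Set (BondConfig V))) ∩ (⋃ t ∈ ({x} : Set V), (openConn t z : Set (BondConfig V)))ᶜ)) ≤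
    (prodBernoulli w).real ({ω : BondConfig V | ∀ s ∈ ({v, o} : Set V), ∀ t ∈ ({x} : Set V), ¬ (openGraph ω).Reachable s t} ∩
        ((openConn v o : Set (BondConfig V)) ∩
          ((⋃ s ∈ ({v, o} : Set V), (openConn s u : Set (BondConfig V))) ∩ (⋃ t ∈ ({x} : Set V), (openConn t z : Set (BondConfig V)))ᶜ))) *
      (prodBernoulli w).real ({ω : BondConfig V | ∀ s ∈ ({v, o} : Set V), ∀ t ∈ ({x} : Set V), ¬ (openGraph ω).Reachable s t} ∩
        (⋃ s ∈ ({v, o} : Set V), (openConn s u : Set (BondConfig V)))ᶜ) := by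
  classical
  set S : Set V := {v, o} with hS
  set T : Set V := {x} with hT
  have hvS : v ∈ S := mem_insert _ _
  -- the four events and their types
  have hI := TwoSetExchange.typePlus_openConn_of_mem S T hvS o
  have hA := TwoSetExchange.typePlus_biUnion_openConn S T u
  have hF := TwoSetExchange.typePlus_not_biUnion_openConn S T z
  have hAc := TwoSetExchange.typeMinus_not_biUnion_openConn S T u
  have hAF : ∀ ⦃ω ω' : BondConfig V⦄, (⋃ s ∈ S, openEdgeCluster ω s) ⊆ (⋃ s ∈ S, openEdgeCluster ω' s) →
      (⋃ t ∈ T, openEdgeCluster ω' t) ⊆ (⋃ t ∈ T, openEdgeCluster ω t) →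
      ω ∈ (⋃ s ∈ S, (openConn s u : Set (BondConfig V))) ∩ (⋃ t ∈ T, (openConn t z : Set (BondConfig V)))ᶜ →
      ω' ∈ (⋃ s ∈ S, (openConn s u : Set (BondConfig V))) ∩ (⋃ t ∈ T, (openConn t z : Set (BondConfig V)))ᶜ :=
    fun ω ω' hs ht h => ⟨hA hs ht h.1, hF hs ht h.2⟩
  have huniv : ∀ ⦃ω ω' : BondConfig V⦄, (⋃ s ∈ S, openEdgeCluster ω' s) ⊆ (⋃ s ∈ S, openEdgeCluster ω s) →
      (⋃ t ∈ T, openEdgeCluster ω t) ⊆ (⋃ t ∈ T, openEdgeCluster ω' t) → ω ∈ (univ : Set (BondConfig V)) →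
      ω' ∈ (univ : Set (BondConfig V)) := fun _ _ _ _ _ => mem_univ _
  have key := setTwoClusterExchange w S T (A₁ := (openConn v o : Set (BondConfig V)))
    (A₂ := (⋃ s ∈ S, (openConn s u : Set (BondConfig V))) ∩ (⋃ t ∈ T, (openConn t z : Set (BondConfig V)))ᶜ)
    (B₁ := (⋃ s ∈ S, (openConn s u : Set (BondConfig V)))ᶜ) (B₂ := univ) hI hAF hAc huniv
  simpa only [inter_univ] using key

/-- **(I10) — the source-side spoiler exchange** (= van den Berg–Häggström–Kahn Thm 1.1 for the source set `S = {v,o,z}`, events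
`{v ↔ o}`, `{u ∈ C_v ∪ C_o}`, avoided sets `{x,u}` and `{x}`).  With `D = {S ↮ x}`:
`μ(D ∩ {v↔o} ∩ {u ∉ C_S}) · μ(D ∩ ({v↔u} ∪ {o↔u})) ≤ μ(D ∩ {v↔o} ∩ ({v↔u} ∪ {o↔u})) · μ(D ∩ {u ∉ C_S})`.
[cite: VandenbergHaggstromKahn2005, Thm. 1.1 (pp. 3–5), Thm. 2.1 (p. 9) at q = 1, Remark 1 after Thm. 1.2 (p. 5)] -/
theorem spoilerExchange_zSource (w : Sym2 V → unitInterval) (x u v o z : V) :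
    (prodBernoulli w).real ({ω : BondConfig V | ∀ s ∈ ({v, o, z} : Set V), ∀ t ∈ ({x} : Set V), ¬ (openGraph ω).Reachable s t} ∩
        ((openConn v o : Set (BondConfig V)) ∩ (⋃ s ∈ ({v, o, z} : Set V), (openConn s u : Set (BondConfig V)))ᶜ)) *
      (prodBernoulli w).real ({ω : BondConfig V | ∀ s ∈ ({v, o, z} : Set V), ∀ t ∈ ({x} : Set V), ¬ (openGraph ω).Reachable s t} ∩
        ((openConn v u : Set (BondConfig V)) ∪ (openConn o u : Set (BondConfig V)))) ≤
    (prodBernoulli w).real ({ω : BondConfig V | ∀ s ∈ ({v, o, z} : Set V), ∀ t ∈ ({x} : Set V), ¬ (openGraph ω).Reachable s t} ∩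
        ((openConn v o : Set (BondConfig V)) ∩ ((openConn v u : Set (BondConfig V)) ∪ (openConn o u : Set (BondConfig V))))) *
      (prodBernoulli w).real ({ω : BondConfig V | ∀ s ∈ ({v, o, z} : Set V), ∀ t ∈ ({x} : Set V), ¬ (openGraph ω).Reachable s t} ∩
        (⋃ s ∈ ({v, o, z} : Set V), (openConn s u : Set (BondConfig V)))ᶜ) := by
  classical
  set S : Set V := {v, o, z} with hS
  set T : Set V := {x} with hT
  have hvS : v ∈ S := mem_insert _ _
  have hoS : o ∈ S := mem_insert_of_mem _ (mem_insert _ _)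
  have hI := TwoSetExchange.typePlus_openConn_of_mem S T hvS o
  have hVu := TwoSetExchange.typePlus_openConn_of_mem S T hvS u
  have hOu := TwoSetExchange.typePlus_openConn_of_mem S T hoS u
  have hAc := TwoSetExchange.typeMinus_not_biUnion_openConn S T u
  have hA : ∀ ⦃ω ω' : BondConfig V⦄, (⋃ s ∈ S, openEdgeCluster ω s) ⊆ (⋃ s ∈ S, openEdgeCluster ω' s) →
      (⋃ t ∈ T, openEdgeCluster ω' t) ⊆ (⋃ t ∈ T, openEdgeCluster ω t) →
      ω ∈ (openConn v u : Set (BondConfig V)) ∪ (openConn o u : Set (BondConfig V)) →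
      ω' ∈ (openConn v u : Set (BondConfig V)) ∪ (openConn o u : Set (BondConfig V)) :=
    fun ω ω' hs ht h => h.elim (fun h1 => Or.inl (hVu hs ht h1)) (fun h2 => Or.inr (hOu hs ht h2))
  have huniv : ∀ ⦃ω ω' : BondConfig V⦄, (⋃ s ∈ S, openEdgeCluster ω' s) ⊆ (⋃ s ∈ S, openEdgeCluster ω s) →
      (⋃ t ∈ T, openEdgeCluster ω t) ⊆ (⋃ t ∈ T, openEdgeCluster ω' t) → ω ∈ (univ : Set (BondConfig V)) →
      ω' ∈ (univ : Set (BondConfig V)) := fun _ _ _ _ _ => mem_univ _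
  have key := setTwoClusterExchange w S T (A₁ := (openConn v o : Set (BondConfig V)))
    (A₂ := (openConn v u : Set (BondConfig V)) ∪ (openConn o u : Set (BondConfig V)))
    (B₁ := (⋃ s ∈ S, (openConn s u : Set (BondConfig V)))ᶜ) (B₂ := univ) hI hA hAc huniv
  simpa only [inter_univ] using key

end Consts

end Summit.CriticalPhenomena.PercolationContinuityZ3.Theorems

end
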